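import Summits.CriticalPhenomena.PercolationContinuityZ3.Theorems.PercNearOneGluingNoHeavyLowerTailSetPortDomination
import HarnessLib

/-!
# `NoHeavyLowerTail` (stmt-CriticalPhenomena-4575) — stripping the witness's coins, and the wall for a relay-neighboured
# set whenever the witness is lightest among the ports WITHOUT the set

Support file (prover `prim-hp-6`, hull-port cell; `--supports stmt-CriticalPhenomena-4575`).  No definitions, no named
facts, no sorries.  Notation as in `…SetPortDomination.lean`; `w ∖ U` = `w` with every pair meeting `U` switched off
(the graph `H − U`), and for a vertex `c` the STRIPPED weights `w ⊖ (U,c)` = `w` with the pairs between `U` and `c`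
switched off.

* `SetPort.real_sep_eq_strip` — both events of `CS_w(U, c)` force the pairs `U–c` closed, so
  `μ_w(E) = ∏_{x ∈ U}(1 − w s(x,c)) · μ_{w ⊖ (U,c)}(E)`; hence (`setCS_of_strip`) `CS_{w ⊖ (U,c)}(U,c) ⇒ CS_w(U,c)`:
  set-champion stability may always be proved in the graph where the witness is NOT adjacent to the set.
* `SetPort.setCS_of_offBest` — **the relay-neighboured wall with the off-set-lightest witness (unconditional).**  If `U` is
  disjoint from `A` and relay-neighboured, `c ∈ A`, and `c` is at least as light as every port of `U` in `w ∖ U`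
  (`μ_{w∖U}{|π(p)| ≤ j} ≤ μ_{w∖U}{|π(c)| ≤ j}`), then `CS_w(U, c)`.  Transport of `Theorems.cil_relayNeighbours_port`'s proof
  (`portComparison_of_separation` + `cil_relayNeighbours_of_portComparison`, witness `c` listed as a zero-weight port of
  the merged anchor) through `SetPort.real_eq_of_merged`.  In particular `CS_H(U, c')` for `c'` a champion of `H − U`.
-/

noncomputable section

namespace Summit.CriticalPhenomena.PercolationContinuityZ3.Theorems

open MeasureTheory Set Literature.Probability.LatticeModels Literature.Probability.Percolation
open scoped Classical BigOperators

variable {n : ℕ}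

namespace SetPort

/-! ### Stripping the pairs between the set and the witness -/

/-- An event contained in `{c ↮ U}` forces the pairs `U–c` closed; its probability factors through the stripped weights:
`μ_w(E) = ∏_{x∈U}(1 − w s(x,c)) · μ_{w'}(E)` for every `w'` that agrees with `w` off those pairs and vanishes on them,
provided `E` evaluated on `ω` and on `ω` minus those pairs agree whenever they are closed… — stated for events `E` with
`E ⊆ {pairs U–c closed}` that are determined by the other pairs up to that constraint. [folklore] -/
theorem real_eq_strip (w w' : Sym2 (Fin n) → unitInterval) (U : Finset (Fin n)) (c : Fin n)
    (hoff : ∀ e : Sym2 (Fin n), e ∉ U.image (fun x => s(x, c)) → w' e = w e)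
    (hzero : ∀ x ∈ U, w' s(x, c) = 0)
    (E : Set (BondConfig (Fin n))) (hEC : ∀ ω ∈ E, ∀ x ∈ U, s(x, c) ∉ ω)
    (hEdet : DeterminedBy {ω : BondConfig (Fin n) | ω \ ↑(U.image fun x => s(x, c)) ∈ E}
      (↑(U.image fun x => s(x, c)) : Set (Sym2 (Fin n)))ᶜ) :
    (prodBernoulli w).real E =
      (∏ e ∈ U.image (fun x => s(x, c)), (1 - (w e : ℝ))) * (prodBernoulli w').real E := by
  set F : Finset (Sym2 (Fin n)) := U.image (fun x => s(x, c)) with hF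
  set C : Set (BondConfig (Fin n)) := {ω | ∀ e ∈ F, e ∉ ω} with hC
  set E' : Set (BondConfig (Fin n)) := {ω | ω \ ↑F ∈ E} with hE'
  -- `E = E' ∩ C`
  have hEq : E = C ∩ E' := by
    ext ω
    constructor
    · intro hω
      have hc : ω ∈ C := by
        intro e he heω
        obtain ⟨x, hx, rfl⟩ := Finset.mem_image.1 he
        exact hEC ω hω x hx heω
      refine ⟨hc, ?_⟩
      show ω \ ↑F ∈ E
      have : ω \ ↑F = ω := by
        ext e; simp only [mem_sdiff, Finset.mem_coe, and_iff_left_iff_imp]; exact fun he heF => hc e heF he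
      rw [this]; exact hω
    · rintro ⟨hc, hE⟩
      have : ω \ ↑F = ω := by
        ext e; simp only [mem_sdiff, Finset.mem_coe, and_iff_left_iff_imp]; exact fun he heF => hc e heF he
      have h' : ω \ ↑F ∈ E := hE
      rwa [this] at h'
  have hdetC : DeterminedBy C (↑F : Set (Sym2 (Fin n))) := by
    rw [determinedBy_iff]
    intro ω ω' h
    simp only [hC, mem_setOf_eq]
    refine forall₂_congr fun e he => ?_
    have := Set.ext_iff.1 h e
    simp only [mem_inter_iff, Finset.mem_coe, he, and_true] at this
    exact not_congr this
  have key : ∀ v : Sym2 (Fin n) → unitInterval, (prodBernoulli v).real E =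
      (∏ e ∈ F, (1 - (v e : ℝ))) * (prodBernoulli v).real E' := by
    intro v
    rw [hEq, prodBernoulli_real_inter_of_determinedBy v F hdetC hEdet (Set.toFinite _).measurableSet
      (Set.toFinite _).measurableSet, hC, prodBernoulli_real_forall_notMem]
  have hE'eq : (prodBernoulli w).real E' = (prodBernoulli w').real E' :=
    prodBernoulli_real_eq_of_determinedBy w w' (fun e he => (hoff e he).symm) hEdet (Set.toFinite _).measurableSet
  have hprod' : ∏ e ∈ F, (1 - (w' e : ℝ)) = 1 := by
    refine Finset.prod_eq_one fun e he => ?_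
    obtain ⟨x, hx, rfl⟩ := Finset.mem_image.1 he
    rw [hzero x hx]; simp
  rw [key w, hE'eq, key w', hprod', one_mul]

/-- The separated events of `CS_w(U,c)` are determined, after closing the pairs `U–c`, by the other pairs, and force
those pairs closed. [folklore] -/
theorem sep_events_strip (A U : Finset (Fin n)) (c : Fin n) (hcU : c ∉ U) (j : ℕ) :
    (∀ ω ∈ {ω : BondConfig (Fin n) | (∀ x ∈ U, ω ∉ openConn c x) ∧
        1 ≤ (A.filter fun z => ∃ x ∈ U, ω ∈ openConn x z).card ∧
        (A.filter fun z => ∃ x ∈ U, ω ∈ openConn x z).card ≤ j}, ∀ x ∈ U, s(x, c) ∉ ω) ∧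
    (∀ ω ∈ {ω : BondConfig (Fin n) | (∀ x ∈ U, ω ∉ openConn c x) ∧
        (A.filter fun z => ω ∈ openConn c z).card ≤ j}, ∀ x ∈ U, s(x, c) ∉ ω) ∧
    DeterminedBy {ω : BondConfig (Fin n) | ω \ ↑(U.image fun x => s(x, c)) ∈
        {ω : BondConfig (Fin n) | (∀ x ∈ U, ω ∉ openConn c x) ∧
          1 ≤ (A.filter fun z => ∃ x ∈ U, ω ∈ openConn x z).card ∧
          (A.filter fun z => ∃ x ∈ U, ω ∈ openConn x z).card ≤ j}}
      (↑(U.image fun x => s(x, c)) : Set (Sym2 (Fin n)))ᶜ ∧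
    DeterminedBy {ω : BondConfig (Fin n) | ω \ ↑(U.image fun x => s(x, c)) ∈
        {ω : BondConfig (Fin n) | (∀ x ∈ U, ω ∉ openConn c x) ∧
          (A.filter fun z => ω ∈ openConn c z).card ≤ j}}
      (↑(U.image fun x => s(x, c)) : Set (Sym2 (Fin n)))ᶜ := by
  have hclosed : ∀ ω : BondConfig (Fin n), (∀ x ∈ U, ω ∉ openConn c x) → ∀ x ∈ U, s(x, c) ∉ ω := by
    intro ω h x hx hxc
    have hne : c ≠ x := fun h' => hcU (h' ▸ hx)
    exact h x hx (show (openGraph ω).Reachable c x from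
      ((openGraph_adj ω c x).2 ⟨by rw [Sym2.eq_swap]; exact hxc, hne⟩).reachable)
  have hdet : ∀ S : Set (BondConfig (Fin n)), DeterminedBy {ω : BondConfig (Fin n) |
      ω \ ↑(U.image fun x => s(x, c)) ∈ S} (↑(U.image fun x => s(x, c)) : Set (Sym2 (Fin n)))ᶜ := by
    intro S
    rw [determinedBy_iff]
    intro ω ω' h
    have : ω \ ↑(U.image fun x => s(x, c)) = ω' \ ↑(U.image fun x => s(x, c)) := by
      rw [Set.sdiff_eq_compl_inter, Set.sdiff_eq_compl_inter, inter_comm, h, inter_comm]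
    simp only [mem_setOf_eq, this]
  exact ⟨fun ω hω => hclosed ω hω.1, fun ω hω => hclosed ω hω.1, hdet _, hdet _⟩

/-- **Stripping.**  Let `c ∉ U` and let `w'` agree with `w` except that the pairs between `U` and `c` are switched off.
Then `CS_{w'}(U, c) ⇒ CS_w(U, c)`. [folklore] -/
theorem setCS_of_strip (w w' : Sym2 (Fin n) → unitInterval) (A U : Finset (Fin n)) (c : Fin n) (hcU : c ∉ U) (j : ℕ)
    (hoff : ∀ e : Sym2 (Fin n), e ∉ U.image (fun x => s(x, c)) → w' e = w e)
    (hzero : ∀ x ∈ U, w' s(x, c) = 0)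
    (hCS : (prodBernoulli w').real {ω : BondConfig (Fin n) | (∀ x ∈ U, ω ∉ openConn c x) ∧
        1 ≤ (A.filter fun z => ∃ x ∈ U, ω ∈ openConn x z).card ∧
        (A.filter fun z => ∃ x ∈ U, ω ∈ openConn x z).card ≤ j} ≤
      (prodBernoulli w').real {ω : BondConfig (Fin n) | (∀ x ∈ U, ω ∉ openConn c x) ∧
        (A.filter fun z => ω ∈ openConn c z).card ≤ j}) :
    (prodBernoulli w).real {ω : BondConfig (Fin n) | (∀ x ∈ U, ω ∉ openConn c x) ∧
        1 ≤ (A.filter fun z => ∃ x ∈ U, ω ∈ openConn x z).card ∧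
        (A.filter fun z => ∃ x ∈ U, ω ∈ openConn x z).card ≤ j} ≤
      (prodBernoulli w).real {ω : BondConfig (Fin n) | (∀ x ∈ U, ω ∉ openConn c x) ∧
        (A.filter fun z => ω ∈ openConn c z).card ≤ j} := by
  obtain ⟨h1, h2, h3, h4⟩ := sep_events_strip A U c hcU j
  rw [real_eq_strip w w' U c hoff hzero _ h1 h3, real_eq_strip w w' U c hoff hzero _ h2 h4]
  exact mul_le_mul_of_nonneg_left hCS (Finset.prod_nonneg fun e _ => sub_nonneg.2 (w e).2.2)

/-! ### The wall with the off-set-lightest witness -/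

/-- **Set-champion stability for a relay-neighboured set, witness lightest among the ports off the set.**  Let `U` be
disjoint from `A`, relay-neighboured with at least one port, `c ∈ A`, and suppose that in the graph `w ∖ U` (all pairs
meeting `U` switched off) `c` is at least as light as every port of `U`.  Then `CS_w(U, c)`.
[cite: VandenbergHaggstromKahn2005, Thm. 1.5 (p. 7) — via `CutObserver.portComparison_of_separation`] -/
theorem setCS_of_offBest (w : Sym2 (Fin n) → unitInterval) (A U : Finset (Fin n)) (hUA : Disjoint U A) (c : Fin n)
    (hcA : c ∈ A) (j : ℕ)
    (hRN : ∀ x ∈ U, ∀ v : Fin n, v ∉ U → w s(x, v) ≠ 0 → v ∈ A)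
    (hport : ∃ x ∈ U, ∃ v : Fin n, v ∉ U ∧ w s(x, v) ≠ 0)
    (hbest : ∀ p ∈ A, (∃ x ∈ U, w s(x, p) ≠ 0) →
      (prodBernoulli fun e => if (∀ u ∈ U, u ∉ e) then w e else 0).real
          {ω : BondConfig (Fin n) | (A.filter fun z => ω ∈ openConn p z).card ≤ j} ≤
        (prodBernoulli fun e => if (∀ u ∈ U, u ∉ e) then w e else 0).real
          {ω : BondConfig (Fin n) | (A.filter fun z => ω ∈ openConn c z).card ≤ j}) :
    (prodBernoulli w).real {ω : BondConfig (Fin n) | (∀ x ∈ U, ω ∉ openConn c x) ∧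
        1 ≤ (A.filter fun z => ∃ x ∈ U, ω ∈ openConn x z).card ∧
        (A.filter fun z => ∃ x ∈ U, ω ∈ openConn x z).card ≤ j} ≤
      (prodBernoulli w).real {ω : BondConfig (Fin n) | (∀ x ∈ U, ω ∉ openConn c x) ∧
        (A.filter fun z => ω ∈ openConn c z).card ≤ j} := by
  have hcU : c ∉ U := fun h => Finset.disjoint_left.1 hUA h hcA
  obtain ⟨x₀, hx₀, v₀, hv₀, hxv₀⟩ := hport
  have hu₁ : x₀ ∈ U := hx₀
  obtain ⟨wm, hoff, hzero, hcoin⟩ := exists_merged w U hu₁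
  -- ports together with `c`, enumerated
  set P : Finset (Fin n) := insert c (A.filter (fun v => ∃ x ∈ U, w s(x, v) ≠ 0)) with hP
  have hPA : ∀ v ∈ P, v ∈ A := by
    intro v hv
    rcases Finset.mem_insert.1 hv with rfl | hv
    · exact hcA
    · exact (Finset.mem_filter.1 hv).1
  have hd : 0 < P.card := Finset.card_pos.2 ⟨c, Finset.mem_insert_self _ _⟩
  set p : Fin P.card → Fin n := fun i => P.orderEmbOfFin rfl i with hp
  have hpinj : Function.Injective p := fun i i' h => (P.orderEmbOfFin rfl).injective h
  have hpP : ∀ l, p l ∈ P := fun l => Finset.orderEmbOfFin_mem P rfl l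
  have hpA : ∀ l, p l ∈ A := fun l => hPA _ (hpP l)
  have hx₀A : x₀ ∉ A := fun h => Finset.disjoint_left.1 hUA hx₀ h
  have hsurj : ∀ v ∈ P, ∃ l : Fin P.card, p l = v := by
    intro v hvP
    have := Finset.range_orderEmbOfFin P rfl
    have hv' : v ∈ Set.range (P.orderEmbOfFin rfl) := by rw [this]; exact hvP
    exact hv'
  obtain ⟨i, hi⟩ := hsurj c (Finset.mem_insert_self _ _)
  -- positive neighbours of the anchor under `wm` are ports
  have hobs : ∀ v, wm s(x₀, v) ≠ 0 → ∃ l, v = p l := by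
    intro v hv
    have hvU : v ∉ U := by
      intro hvU
      exact hv (hzero _ ⟨x₀, hx₀, Sym2.mem_mk_left x₀ v⟩ (by
        rintro ⟨v', hv', he⟩
        rcases Sym2.eq_iff.1 he with ⟨-, h⟩ | ⟨h, -⟩
        · exact hv' (h ▸ hvU)
        · exact hv' (h ▸ hx₀)))
    have hprod : ∏ x ∈ U, (1 - (w s(x, v) : ℝ)) ≠ 1 := by
      intro h1
      have := hcoin v hvU
      rw [h1] at this
      have h0 : (wm s(x₀, v) : ℝ) = 0 := by linarith
      exact hv (Subtype.ext h0)
    have : ∃ x ∈ U, w s(x, v) ≠ 0 := by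
      by_contra hall
      refine hprod (Finset.prod_eq_one fun x hx => ?_)
      have h0 : w s(x, v) = 0 := by by_contra h; exact hall ⟨x, hx, h⟩
      rw [h0]; simp
    obtain ⟨x, hx, hxv⟩ := this
    have hvP : v ∈ P := Finset.mem_insert_of_mem (by
      simp only [Finset.mem_filter]; exact ⟨hRN x hx v hvU hxv, x, hx, hxv⟩)
    obtain ⟨l, hl⟩ := hsurj v hvP
    exact ⟨l, hl.symm⟩
  -- lightness off the anchor under `wm` is lightness in `w ∖ U`
  have hwoff : (fun e => if e ∈ {e : Sym2 (Fin n) | x₀ ∉ e} then wm e else 0) =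
      (fun e => if (∀ u ∈ U, u ∉ e) then w e else 0) := by
    funext e
    by_cases hU : ∀ u ∈ U, u ∉ e
    · have hx : e ∈ {e : Sym2 (Fin n) | x₀ ∉ e} := hU x₀ hx₀
      rw [if_pos hx, if_pos hU, hoff e hU]
    · rw [if_neg hU]
      by_cases hx : e ∈ {e : Sym2 (Fin n) | x₀ ∉ e}
      · rw [if_pos hx]
        refine hzero e ?_ ?_
        · by_contra h
          exact hU fun u hu hue => h ⟨u, hu, hue⟩
        · rintro ⟨v, -, rfl⟩
          exact hx (Sym2.mem_mk_left x₀ v)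
      · rw [if_neg hx]
  have hsH : ∀ m : Fin P.card,
      (prodBernoulli wm).real {ω : BondConfig (Fin n) |
          (A.filter fun x => (openGraph (ω ∩ {e | x₀ ∉ e})).Reachable (p m) x).card ≤ j} =
        (prodBernoulli fun e => if (∀ u ∈ U, u ∉ e) then w e else 0).real
          {ω : BondConfig (Fin n) | (A.filter fun z => ω ∈ openConn (p m) z).card ≤ j} := by
    intro m
    rw [← hwoff, ← CutObserver.measureReal_preimage_avoid wm x₀]
    congr 1
    ext ω
    simp only [mem_setOf_eq, openConn]
  -- the port comparison for the witness `c = p i`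
  have hstar : ∀ l, l ≠ i →
      (prodBernoulli wm).real
          ({ω : BondConfig (Fin n) | ¬ (openGraph (ω ∩ {e | x₀ ∉ e})).Reachable (p l) (p i)} ∩
            {ω | ∀ m, l < m → (openGraph (ω ∩ {e | x₀ ∉ e})).Reachable (p m) (p i) → s(x₀, p m) ∉ ω} ∩
            {ω | (A.filter fun x => (openGraph (ω ∩ {e | x₀ ∉ e})).Reachable (p l) x).card ≤ j}) ≤
        (prodBernoulli wm).real
          ({ω : BondConfig (Fin n) | ¬ (openGraph (ω ∩ {e | x₀ ∉ e})).Reachable (p l) (p i)} ∩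
            {ω | ∀ m, l < m → (openGraph (ω ∩ {e | x₀ ∉ e})).Reachable (p m) (p i) → s(x₀, p m) ∉ ω} ∩
            {ω | (A.filter fun x => (openGraph (ω ∩ {e | x₀ ∉ e})).Reachable (p i) x).card ≤ j}) := by
    intro l hli
    have hs : (prodBernoulli wm).real {ω : BondConfig (Fin n) |
        (A.filter fun x => (openGraph (ω ∩ {e | x₀ ∉ e})).Reachable (p l) x).card ≤ j} ≤
      (prodBernoulli wm).real {ω : BondConfig (Fin n) |
        (A.filter fun x => (openGraph (ω ∩ {e | x₀ ∉ e})).Reachable (p i) x).card ≤ j} := by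
      rw [hsH l, hsH i, hi]
      have hplP := hpP l
      rcases Finset.mem_insert.1 hplP with hpc | hpl
      · exact absurd (hpinj (hpc.trans hi.symm)) hli
      · exact hbest (p l) (hpA l) (Finset.mem_filter.1 hpl).2
    have key := CutObserver.portComparison_of_separation wm A x₀ j p hpinj (Ne.symm hli) hs
      (Finset.univ.filter fun m => l < m) {p l}
    have e : ∀ x : Fin P.card,
        {ω : BondConfig (Fin n) | ¬ (openGraph (ω ∩ {e | x₀ ∉ e})).Reachable (p l) (p i)} ∩
          {ω | ∀ m, l < m → (openGraph (ω ∩ {e | x₀ ∉ e})).Reachable (p m) (p i) → s(x₀, p m) ∉ ω} ∩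
          {ω | (A.filter fun y => (openGraph (ω ∩ {e | x₀ ∉ e})).Reachable (p x) y).card ≤ j} =
        {ω : BondConfig (Fin n) | ∀ m ∈ (Finset.univ.filter fun m => l < m),
            (openGraph (ω ∩ {e | x₀ ∉ e})).Reachable (p m) (p i) → s(x₀, p m) ∉ ω} ∩
          {ω | ∀ v ∈ ({p l} : Finset (Fin n)), ¬ (openGraph (ω ∩ {e | x₀ ∉ e})).Reachable v (p i)} ∩
          {ω | (A.filter fun y => (openGraph (ω ∩ {e | x₀ ∉ e})).Reachable (p x) y).card ≤ j} := by
      intro x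
      ext ω
      simp only [Finset.mem_filter, Finset.mem_univ, true_and, Finset.mem_singleton, forall_eq, mem_inter_iff,
        mem_setOf_eq]
      tauto
    rw [e l, e i]
    exact key
  have hcil := cil_relayNeighbours_of_portComparison wm A x₀ j p hpinj hpA hx₀A hobs i hstar
  rw [hi] at hcil
  -- back to the set events under `w`
  rw [← real_bad_eq_anchor w wm A U hUA hu₁ j hoff hzero hcoin,
    ← glued_eq_lightness_anchor w wm A U hUA hu₁ hcU j hoff hzero hcoin] at hcil
  exact (CutObserver.bad_le_glued_iff_setCS w A U c j hcA).2 hcil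

end SetPort

end Summit.CriticalPhenomena.PercolationContinuityZ3.Theorems

end
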